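import Literature.Computability.Complexity.XorFiberGrowth
import HarnessLib

/-!
# Linearity testing over `GF(2)` (Blum–Luby–Rubinfeld) and the Walsh–Hadamard code

The two facts about linear functions `x ↦ u ⊙ x = ∑ᵢ uᵢ xᵢ (mod 2)` on `GF(2)ⁿ = {0,1}ⁿ` that the
Walsh–Hadamard-based PCPs rest on (Arora–Barak 2009, §11.5.1: the exponential-size PCP for NP,
Thm. 11.19; §22.2.5: alphabet reduction in the proof of the PCP theorem), proved by Fourier analysis
on the Boolean cube exactly as in §22.5.3 of the book:

* the **random subsum principle** (Claim A.31 / §11.5.1): if `u ≠ v` then `u ⊙ x ≠ v ⊙ x` for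
  exactly half of the `x` — the Walsh–Hadamard code has relative distance `1/2`
  (`two_mul_card_dot_ne`);
* **Theorem 22.22**: if `f : {0,1}ⁿ → {0,1}` passes the BLR test `f(x + y) = f(x) + f(y)` for at
  least a `1/2 + ε` fraction of the pairs `(x, y)`, then some Fourier coefficient of `(-1)^f` is
  `≥ 2ε` (`exists_cubeFourierCoeff_ge`; the real-valued core `sum_cubeFourierCoeff_pow_three_le` only
  needs `⟨F, F⟩ = 1`, as remarked in the printed proof);
* **Theorem 11.21** (linearity testing, [BLR90]): if the test passes with probability `≥ ρ` then `f`
  is `ρ`-close (Def. 11.20) to a linear function (`linearityTest`; the printed hypothesis `ρ > 1/2`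
  is not needed for the conclusion and is dropped).

Vectors are `Fin n → Bool` with the coordinatewise sum `xorVec` (`XorFiberGrowth.lean`), sums and
counts are finite (`Finset.card`, `∑`); probabilities are cleared of denominators
(`ρ · 4ⁿ ≤ #{accepting pairs}`, `ρ · 2ⁿ ≤ #{agreements}`).  The characters
`walsh S x = ∏_{i ∈ S} (-1)^{xᵢ}`, the sign `sgn b = (-1)^b` (`Literature.Probability.RandomGraphs.LowDegree`),
their multiplicativity `walsh_xorVec`, and the coefficients `cubeFourierCoeff g S = 𝔼ₓ[g(x) χ_S(x)]`
with inversion and Parseval (`BooleanFourier.lean`) are the tree's; the bridge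
`(-1)^{u ⊙ x} = χ_{supp u}(x)` is `sgn_dot`.
Mathlib has no Boolean-cube property testing (searched `linearity`, `Hadamard code`, `BLR`).

## References

* S. Arora, B. Barak, *Computational Complexity: A Modern Approach*, CUP 2009, §11.5.1
  (Walsh–Hadamard code, random subsum principle, Def. 11.20, Thm. 11.21), §22.5.3 (Thm. 22.22 and
  its proof), Claim A.31.
* M. Blum, M. Luby, R. Rubinfeld, *Self-testing/correcting with applications to numerical
  problems*, J. Comput. Syst. Sci. 47 (1993) (STOC 1990).
* R. O'Donnell, *Analysis of Boolean Functions*, CUP 2014, §1.6 (BLR test).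
-/

noncomputable section

namespace Literature.Computability.Complexity

open Finset Literature.Probability.RandomGraphs.LowDegree Literature.Computability.Complexity.LowDegree

namespace BLR

variable {n : ℕ}

/-! ### Vectors over `GF(2)`: inner product, linear functions, closeness, the test -/

/-- The inner product `u ⊙ x = ∑ᵢ uᵢ xᵢ (mod 2)` of `GF(2)ⁿ`, as a bit. [cite: AroraBarakCC2009, §11.5.1] -/
def dot (u x : Fin n → Bool) : Bool :=
  decide (Odd ((univ.filter fun i => u i = true ∧ x i = true).card))

/-- The number of points on which two Boolean functions on `{0,1}ⁿ` agree. [cite: AroraBarakCC2009, Def. 11.20] -/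
def agree (f g : (Fin n → Bool) → Bool) : ℕ := (univ.filter fun x => f x = g x).card

/-- `f` and `g` are `ρ`-close: `Pr_x[f x = g x] ≥ ρ`, i.e. `ρ · 2ⁿ ≤ #{x | f x = g x}`
(Arora–Barak, Def. 11.20). [cite: AroraBarakCC2009, Def. 11.20] -/
def IsClose (ρ : ℝ) (f g : (Fin n → Bool) → Bool) : Prop := ρ * 2 ^ n ≤ agree f g

/-- The number of pairs `(x, y)` on which `f` passes the BLR linearity test `f(x + y) = f(x) + f(y)`.
[cite: AroraBarakCC2009, §11.5.1 (eq. (11.3))] -/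
def passCount (f : (Fin n → Bool) → Bool) : ℕ :=
  (univ.filter fun p : (Fin n → Bool) × (Fin n → Bool) => f (xorVec p.1 p.2) = xor (f p.1) (f p.2)).card

/-! ### Signs and characters -/

/-- A character is `(-1)` to the number of coordinates of `S` that are set. [folklore] -/
theorem walsh_eq_neg_one_pow (S : Finset (Fin n)) (x : Fin n → Bool) :
    walsh S x = (-1) ^ (S.filter fun i => x i = true).card := by
  rw [walsh]
  have : ∀ i ∈ S, sgn (x i) = if x i = true then (-1 : ℝ) else 1 := fun i _ => by
    cases x i <;> simp [sgn]
  rw [prod_congr rfl this, prod_ite, prod_const_one, mul_one, prod_const]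

/-- **Linear functions are characters in the `±1` view**: `(-1)^{u ⊙ x} = χ_{supp u}(x)`.
[cite: AroraBarakCC2009, §22.5.1 ("the Fourier basis is the Walsh–Hadamard code in disguise")] -/
theorem sgn_dot (u x : Fin n → Bool) : sgn (dot u x) = walsh (univ.filter fun i => u i = true) x := by
  rw [walsh_eq_neg_one_pow, filter_filter, dot]
  by_cases h : Odd ((univ.filter fun i => u i = true ∧ x i = true).card)
  · rw [decide_eq_true h, sgn_true, h.neg_one_pow]
  · rw [decide_eq_false h, sgn_false, (Nat.not_odd_iff_even.1 h).neg_one_pow]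

/-- Distinct vectors have distinct supports. [folklore] -/
theorem filter_ne_of_ne {u v : Fin n → Bool} (h : u ≠ v) :
    (univ.filter fun i => u i = true) ≠ univ.filter fun i => v i = true := by
  intro hS
  apply h
  funext i
  have := congrArg (i ∈ ·) hS
  simp only [mem_filter, mem_univ, true_and, eq_iff_iff] at this
  cases hu : u i <;> cases hv : v i <;> simp_all

/-! ### The random subsum principle -/

/-- The sign of agreement: `(-1)^a (-1)^b` is `1` if `a = b` and `-1` otherwise. [folklore] -/
theorem sgn_mul_sgn_eq_ite (a b : Bool) : sgn a * sgn b = if a = b then 1 else -1 := by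
  cases a <;> cases b <;> simp [sgn]

/-- **A sum of agreement signs counts agreements**: `∑_x (-1)^{f x} (-1)^{g x} = 2 #{f = g} - 2ⁿ`. [folklore] -/
theorem sum_sgn_mul_sgn (f g : (Fin n → Bool) → Bool) :
    ∑ x, sgn (f x) * sgn (g x) = 2 * (agree f g : ℝ) - 2 ^ n := by
  simp_rw [sgn_mul_sgn_eq_ite]
  rw [Finset.sum_ite, sum_const, sum_const, nsmul_eq_mul, nsmul_eq_mul, mul_one, agree]
  have hcard := Finset.card_filter_add_card_filter_not (s := (univ : Finset (Fin n → Bool)))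
    (fun x => f x = g x)
  rw [card_univ, Fintype.card_fun, Fintype.card_bool, Fintype.card_fin] at hcard
  have h' : (((univ : Finset (Fin n → Bool)).filter fun x => ¬ f x = g x).card : ℝ) =
      2 ^ n - ((univ : Finset (Fin n → Bool)).filter fun x => f x = g x).card := by
    rw [eq_sub_iff_add_eq, add_comm]
    exact_mod_cast hcard
  rw [h']
  ring

/-- **Random subsum principle** (Arora–Barak, Claim A.31 / §11.5.1): if `u ≠ v` then `u ⊙ x ≠ v ⊙ x`
for exactly half of the vectors `x` — the Walsh–Hadamard codewords of `u ≠ v` differ in exactly half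
of their `2ⁿ` bits. [cite: AroraBarakCC2009, Claim A.31 and §11.5.1 (random subsum principle)] -/
theorem two_mul_card_dot_ne {u v : Fin n → Bool} (h : u ≠ v) :
    2 * (univ.filter fun x => dot u x ≠ dot v x).card = 2 ^ n := by
  have horth := sum_walsh_mul_walsh_index (univ.filter fun i => u i = true) (univ.filter fun i => v i = true)
  rw [if_neg (filter_ne_of_ne h)] at horth
  simp_rw [← sgn_dot] at horth
  rw [sum_sgn_mul_sgn] at horth
  have hcard := Finset.card_filter_add_card_filter_not (s := (univ : Finset (Fin n → Bool)))
    (fun x => dot u x = dot v x)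
  rw [card_univ, Fintype.card_fun, Fintype.card_bool, Fintype.card_fin] at hcard
  have h1 : 2 * (agree (dot u) (dot v) : ℝ) = 2 ^ n := by linarith
  have h2 : 2 * agree (dot u) (dot v) = 2 ^ n := by exact_mod_cast h1
  unfold agree at h2
  show 2 * (univ.filter fun x => ¬ dot u x = dot v x).card = 2 ^ n
  omega

/-! ### The cubic Fourier identity of the BLR test -/

/-- `∑ₓ F(x) χ_S(x) = 2ⁿ F̂(S)`. [cite: ODonnell2014, §1.2] -/
theorem sum_mul_walsh_eq (F : (Fin n → Bool) → ℝ) (S : Finset (Fin n)) :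
    ∑ x, F x * walsh S x = 2 ^ n * cubeFourierCoeff F S := by
  rw [cubeFourierCoeff, mul_div_cancel₀ _ (by positivity)]

/-- **The cubic identity** (Arora–Barak, proof of Thm. 22.22): `𝔼_{x,y}[F(x) F(y) F(x + y)] = ∑_S F̂(S)³`,
i.e. `∑_{x,y} F(x) F(y) F(x + y) = 4ⁿ ∑_S F̂(S)³`, for every real `F` on the cube (expand `F(x + y)`,
use `χ_S(x + y) = χ_S(x) χ_S(y)` and sum over `x` and `y` separately).
[cite: AroraBarakCC2009, Thm. 22.22 (proof)] -/
theorem sum_sum_mul_mul_xorVec (F : (Fin n → Bool) → ℝ) :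
    ∑ x, ∑ y, F x * F y * F (xorVec x y) = 4 ^ n * ∑ S, cubeFourierCoeff F S ^ 3 := by
  calc ∑ x, ∑ y, F x * F y * F (xorVec x y)
      = ∑ x, ∑ y, ∑ S, cubeFourierCoeff F S * ((F x * walsh S x) * (F y * walsh S y)) := by
        refine sum_congr rfl fun x _ => sum_congr rfl fun y _ => ?_
        rw [← sum_cubeFourierCoeff_mul_walsh F (xorVec x y), mul_sum]
        refine sum_congr rfl fun S _ => ?_
        rw [walsh_xorVec]
        ring
    _ = ∑ x, ∑ S, ∑ y, cubeFourierCoeff F S * ((F x * walsh S x) * (F y * walsh S y)) :=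
        sum_congr rfl fun x _ => sum_comm
    _ = ∑ S, ∑ x, ∑ y, cubeFourierCoeff F S * ((F x * walsh S x) * (F y * walsh S y)) := sum_comm
    _ = ∑ S, cubeFourierCoeff F S * ((∑ x, F x * walsh S x) * ∑ y, F y * walsh S y) := by
        refine sum_congr rfl fun S _ => ?_
        rw [sum_mul_sum, mul_sum]
        refine sum_congr rfl fun x _ => ?_
        rw [mul_sum]
    _ = 4 ^ n * ∑ S, cubeFourierCoeff F S ^ 3 := by
        rw [mul_sum]
        refine sum_congr rfl fun S _ => ?_
        rw [sum_mul_walsh_eq, show (4 : ℝ) ^ n = 2 ^ n * 2 ^ n by rw [← mul_pow]; norm_num]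
        ring

/-- **`∑_S F̂(S)³ ≤ max_S F̂(S)` when `⟨F, F⟩ = 1`** (Parseval: `∑_S F̂(S)² = 𝔼[F²] = 1`).
[cite: AroraBarakCC2009, Thm. 22.22 (proof)] -/
theorem sum_cubeFourierCoeff_pow_three_le (F : (Fin n → Bool) → ℝ) (hF : ∑ x, F x ^ 2 = 2 ^ n) :
    ∑ S, cubeFourierCoeff F S ^ 3 ≤ univ.sup' univ_nonempty (cubeFourierCoeff F) := by
  set M := univ.sup' univ_nonempty (cubeFourierCoeff F)
  have hpars : ∑ S, cubeFourierCoeff F S ^ 2 = 1 := by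
    rw [sum_cubeFourierCoeff_sq, hF, div_self (by positivity)]
  calc ∑ S, cubeFourierCoeff F S ^ 3 ≤ ∑ S, M * cubeFourierCoeff F S ^ 2 := by
        refine sum_le_sum fun S _ => ?_
        rw [pow_succ', sq]
        exact mul_le_mul_of_nonneg_right (le_sup' (cubeFourierCoeff F) (mem_univ S)) (mul_self_nonneg _)
    _ = M := by rw [← mul_sum, hpars, mul_one]

/-- A `±1`-valued function has `⟨F, F⟩ = 1`: `∑ₓ ((-1)^{f x})² = 2ⁿ`. [cite: AroraBarakCC2009, §22.5.2] -/
theorem sum_sgn_sq (f : (Fin n → Bool) → Bool) : ∑ x, sgn (f x) ^ 2 = (2 : ℝ) ^ n := by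
  have : ∀ x : Fin n → Bool, sgn (f x) ^ 2 = (1 : ℝ) := fun x => by rw [sq, sgn_mul_self]
  rw [sum_congr rfl fun x _ => this x, sum_const, card_univ, Fintype.card_fun, Fintype.card_bool,
    Fintype.card_fin, nsmul_eq_mul, mul_one]
  norm_num

/-- **The acceptance count of the BLR test in Fourier terms**:
`2 · #{(x,y) | f(x+y) = f(x) + f(y)} = 4ⁿ (1 + ∑_S F̂(S)³)` for `F = (-1)^f` (the indicator of
acceptance is `(1 + F(x) F(y) F(x+y)) / 2`). [cite: AroraBarakCC2009, Thm. 22.22 (proof, first line)] -/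
theorem two_mul_passCount (f : (Fin n → Bool) → Bool) :
    2 * (passCount f : ℝ) = 4 ^ n * (1 + ∑ S, cubeFourierCoeff (fun x => sgn (f x)) S ^ 3) := by
  have hind : ∀ p : (Fin n → Bool) × (Fin n → Bool),
      (if f (xorVec p.1 p.2) = xor (f p.1) (f p.2) then (1 : ℝ) else 0) =
        (1 + sgn (f p.1) * sgn (f p.2) * sgn (f (xorVec p.1 p.2))) / 2 := fun p => by
    rw [← sgn_xor, sgn_mul_sgn_eq_ite]
    by_cases h : f (xorVec p.1 p.2) = xor (f p.1) (f p.2)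
    · rw [if_pos h, if_pos h.symm]; norm_num
    · rw [if_neg h, if_neg (Ne.symm h)]; norm_num
  have hcount : (passCount f : ℝ) = ∑ p : (Fin n → Bool) × (Fin n → Bool),
      (if f (xorVec p.1 p.2) = xor (f p.1) (f p.2) then (1 : ℝ) else 0) := by
    rw [passCount, Finset.sum_boole]
  have hcube := sum_sum_mul_mul_xorVec fun x => sgn (f x)
  rw [hcount, sum_congr rfl fun p _ => hind p, ← sum_div, mul_div_cancel₀ _ (two_ne_zero),
    sum_add_distrib, sum_const, card_univ, Fintype.card_prod, Fintype.card_fun, Fintype.card_bool,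
    Fintype.card_fin, nsmul_eq_mul, mul_one, Fintype.sum_prod_type]
  dsimp only
  rw [hcube]
  push_cast
  rw [show ((2 : ℝ) ^ n * 2 ^ n) = 4 ^ n by rw [← mul_pow]; norm_num]
  ring

/-! ### Theorem 22.22 and Theorem 11.21 -/

/-- **Arora–Barak, Theorem 22.22** (in the `GF(2)` view): if `f : {0,1}ⁿ → {0,1}` satisfies
`Pr_{x,y}[f(x+y) = f(x) + f(y)] ≥ 1/2 + ε`, i.e. `(1/2 + ε) 4ⁿ ≤ #{accepting pairs}`, then some
Fourier coefficient of `F = (-1)^f` is at least `2ε`: `∃ S, F̂(S) ≥ 2ε`.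
[cite: AroraBarakCC2009, Thm. 22.22] -/
theorem exists_cubeFourierCoeff_ge (f : (Fin n → Bool) → Bool) {ε : ℝ}
    (h : (1 / 2 + ε) * 4 ^ n ≤ passCount f) :
    ∃ S : Finset (Fin n), 2 * ε ≤ cubeFourierCoeff (fun x => sgn (f x)) S := by
  obtain ⟨S, -, hS⟩ := exists_mem_eq_sup' univ_nonempty (cubeFourierCoeff fun x => sgn (f x))
  refine ⟨S, ?_⟩
  rw [← hS]
  refine le_trans ?_ (sum_cubeFourierCoeff_pow_three_le _ (sum_sgn_sq f))
  have h2 := two_mul_passCount f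
  have h4 : (0 : ℝ) < 4 ^ n := by positivity
  nlinarith

/-- **The agreement of `f` with the linear function `x ↦ u ⊙ x` in Fourier terms**:
`2 #{x | f x = u ⊙ x} = 2ⁿ (1 + F̂(supp u))`, `F = (-1)^f` ("`f` has agreement `1/2 + ε/2` with `g`
iff `⟨f, g⟩ = ε`"). [cite: AroraBarakCC2009, §22.5.3] -/
theorem two_mul_agree_dot (f : (Fin n → Bool) → Bool) (u : Fin n → Bool) :
    2 * (agree f (dot u) : ℝ) = 2 ^ n * (1 + cubeFourierCoeff (fun x => sgn (f x)) (univ.filter fun i => u i = true)) := by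
  rw [mul_add, mul_one, ← sum_mul_walsh_eq]
  simp_rw [← sgn_dot]
  rw [sum_sgn_mul_sgn]
  ring

/-- **Arora–Barak, Theorem 11.21 (Linearity Testing, Blum–Luby–Rubinfeld 1990).** Let
`f : {0,1}ⁿ → {0,1}` be such that `Pr_{x,y}[f(x + y) = f(x) + f(y)] ≥ ρ`, i.e.
`ρ · 4ⁿ ≤ #{(x,y) | f(x+y) = f(x) + f(y)}`.  Then `f` is `ρ`-close to a linear function: for some
`u ∈ {0,1}ⁿ`, `Pr_x[f x = u ⊙ x] ≥ ρ` (`IsClose ρ f (dot u)`, Def. 11.20).  Printed with the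
hypothesis `ρ > 1/2`, which the conclusion does not need (for `ρ ≤ 1/2` it still says that some
linear function agrees with `f` on a `ρ` fraction); proof as in §22.5.3: with `ρ = 1/2 + ε`,
Thm. 22.22 gives `F̂(S) ≥ 2ε` for some `S`, and the linear function `x ↦ 1_S ⊙ x` agrees with `f` on
`2ⁿ (1 + F̂(S))/2 ≥ ρ 2ⁿ` points. [cite: AroraBarakCC2009, Thm. 11.21] -/
theorem linearityTest (f : (Fin n → Bool) → Bool) {ρ : ℝ} (h : ρ * 4 ^ n ≤ passCount f) :
    ∃ u : Fin n → Bool, IsClose ρ f (dot u) := by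
  obtain ⟨S, hS⟩ := exists_cubeFourierCoeff_ge f (ε := ρ - 1 / 2) (by linarith)
  refine ⟨fun i => decide (i ∈ S), ?_⟩
  have hsupp : (univ.filter fun i => decide (i ∈ S) = true) = S := by
    ext i; simp
  have h2 := two_mul_agree_dot f fun i => decide (i ∈ S)
  rw [hsupp] at h2
  unfold IsClose
  have h4 : (0 : ℝ) < 2 ^ n := by positivity
  nlinarith

/-- **Perfect completeness of the test**: a linear function passes on every pair
(`u ⊙ (x + y) = u ⊙ x + u ⊙ y`). [cite: AroraBarakCC2009, §11.5.1 ("accepts a linear function with probability 1")] -/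
theorem dot_xorVec (u x y : Fin n → Bool) : dot u (xorVec x y) = xor (dot u x) (dot u y) := by
  have h := walsh_xorVec (univ.filter fun i => u i = true) x y
  rw [← sgn_dot, ← sgn_dot, ← sgn_dot, ← sgn_xor] at h
  revert h
  cases dot u (xorVec x y) <;> cases xor (dot u x) (dot u y) <;> simp [sgn] <;> norm_num

/-- Hence the linear functions pass the BLR test on all `4ⁿ` pairs. [cite: AroraBarakCC2009, §11.5.1] -/
theorem passCount_dot (u : Fin n → Bool) : passCount (dot u) = 4 ^ n := by
  rw [passCount, filter_true_of_mem fun p _ => dot_xorVec u p.1 p.2, card_univ, Fintype.card_prod,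
    Fintype.card_fun, Fintype.card_bool, Fintype.card_fin, ← mul_pow]
  norm_num

end BLR

end Literature.Computability.Complexity

end
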